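import Summits.ABC.ABC.Theorems.IsogenyGlueCongruenceEllipticGluingPrimeBoundOfFreeThree
import Summits.ABC.ABC.Theorems.IsogenyGlueCongruenceEllipticGluingPrimeBoundStubQuotientByAbelianSubvariety
import Summits.ABC.ABC.Theorems.IsogenyGlueCongruenceEllipticGluingPrimeBoundStubFreeOfSimple
import Summits.ABC.ABC.Theorems.IsogenyGlueCongruenceEllipticGluingPrimeBoundSimpleOfBound
import HarnessLib

/-!
# Crux U `EllipticGluingPrimeBound` (stmt-ABC-13919): U ⟺ U_simple modulo three published inputs

Final form of the reduction theorem of line `Sketch` (isotypic–Minkowski reduction, skeleton v12),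
superseding `ellipticGluingPrimeBound_of_free_v2` (…OfFreeThree.lean, p117349) by sharpening the
residual from `U_free` to `U_simple`: `EllipticGluingPrimeBound` follows from

* `U_simple` — the height-free torsion-sharing bound with **ℚ-simple**, GEOMETRICALLY `E`-FREE
  partners at primes where `W[ℓ]` is irreducible (the line's registered residual stub
  `stub_simpleFreeTorsionBound`, an open problem of generalized Frey–Mazur type; here the
  hypothesis `hS`), and
* THREE published inputs: Masser–Wüstholz 1993 (`masserWustholz_surjective_modEll`), the main
  theorem of complex multiplication on `ℓ`-torsion (`cmTorsion_cartanImage`), and Faltings 1983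
  in the form of the route ITEM `FaltingsTate` (stmt-ABC-15664);

and conversely `EllipticGluingPrimeBound → U_simple` unconditionally
(`simpleFreeTorsionBound_of_ellipticGluingPrimeBound`, p117529). Hence, modulo the three inputs,
**the crux is EQUIVALENT to `U_simple`** (`ellipticGluingPrimeBound_iff_simple`).

* `bound_of_branches₃` — the real-analysis bookkeeping (v11 form: the free bound carries the
  irreducibility of `W[ℓ]`, which the composition has in hand where it is used);
* `ellipticGluingPrimeBound_of_simple` — the reduction theorem (conditional result; it does not
  close the item, whose residual is exactly `U_simple`);
* `ellipticGluingPrimeBound_iff_simple` — the equivalence modulo the three inputs.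

Lands `--supports stmt-ABC-13919`. No new definitions; no `sorry`.
-/

noncomputable section

-- `Summit.<Summit>.<Problem>` is the mandated summit-side namespace (CONVENTIONS §2); for the
-- single-conjunct summit `ABC` the two coincide, so the duplicate `ABC.ABC` is deliberate.
set_option linter.dupNamespace false

namespace Summit.ABC.ABC.Theorems.IsotypicMinkowski

open CategoryTheory CategoryTheory.Limits AlgebraicGeometry
open Literature.AlgebraicGeometry.Motives
open Summit.ABC.ABC.Theses.IsogenyGlueCongruence

/-- **Composition of the line (v11).** Irreducibility threshold + dichotomy-given-irreducibility +
polynomial isotypic-branch bound + free-branch bound give the body of the crux (stated unfolded, so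
that exactly one theorem of the file concludes the crux by name), with
`κ' = max 1 (max γ₀ (max γ κ))` and `C' = max L₀ L₁ + max c₀ 0 + max c 0 + max C 0`: in a glued
instance the base `X = dim B · max 1 h_F(W)` is `≥ max 1 h_F(W) ≥ 1`; primes `ℓ ≤ max L₀ L₁` are
absorbed by the constant; primes `ℓ ≤ c₀ · max(1,h)^γ₀` (below the irreducibility threshold) give
`ℓ ≤ max c₀ 0 · X^κ'`; beyond both, `W[ℓ]` is irreducible (`hT`), the dichotomy (`hD`) applies, the
isotypic case gives `ℓ ≤ c (dim B₁ · max 1 h)^γ ≤ max c 0 · X^κ'` (`dim B₁ ≤ dim B`) and the free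
case `ℓ ≤ C ((dim A + 1) max 1 h)^κ ≤ max C 0 · X^κ'` (`dim A + 1 ≤ dim B`).  The four hypotheses
are the conclusions of `stub_dichotomyOfIrreducible`, `stub_irreducibleThreshold`,
`stub_isotypicBranchPolyOf` (all landed) and of `stub_freeOfSimple` fed with `U_simple`; the free bound
is only ever invoked at primes where `W[ℓ]` is irreducible, so it carries that hypothesis. -/
theorem bound_of_branches₃
    (hD : ∀ (W : WeierstrassCurve ℚ) [W.IsElliptic] (E B : AbelianVariety.{0} ℚ)
      (e : E.geomPoints ≃+ W.geomPoints),
      (∀ (σ : Field.absoluteGaloisGroup ℚ) (P : E.geomPoints), e (σ • P) = σ • e P) →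
      ∀ ℓ : ℕ, ℓ.Prime → W.HasIrreducibleModPGaloisRep ℓ →
      (∃ (α : E ⟶ B) (β : B ⟶ E) (n : ℤ), n ≠ 0 ∧ α ≫ β = n • 𝟙 E) →
      (∀ (α : E ⟶ B) (β : B ⟶ E) (n : ℤ), α ≫ β = n • 𝟙 E → (ℓ : ℤ) ∣ n) →
      (∃ B₁ : AbelianVariety.{0} ℚ, B₁.dim ≤ B.dim ∧
        (∀ (C : AbelianVariety.{0} (AlgebraicClosure ℚ))
            (g : B₁.baseChange (AlgebraicClosure ℚ) ⟶ C),
            Surjective (AbelianVariety.Hom.toSchemeHom g) → C.dim ≠ 0 →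
            ∃ f : E.baseChange (AlgebraicClosure ℚ) ⟶ C, f ≠ 0) ∧
        (∃ (α : E ⟶ B₁) (β : B₁ ⟶ E) (n : ℤ), n ≠ 0 ∧ α ≫ β = n • 𝟙 E) ∧
        (∀ (α : E ⟶ B₁) (β : B₁ ⟶ E) (n : ℤ), α ≫ β = n • 𝟙 E → (ℓ : ℤ) ∣ n)) ∨
      (∃ A : AbelianVariety.{0} ℚ, A.dim + 1 ≤ B.dim ∧
        (∀ f : E.baseChange (AlgebraicClosure ℚ) ⟶ A.baseChange (AlgebraicClosure ℚ), f = 0) ∧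
        ∃ ι : W.geomTorsion ℓ →+ A.geomPoints, Function.Injective ι ∧
          ∀ (σ : Field.absoluteGaloisGroup ℚ) (P : W.geomTorsion ℓ), ι (σ • P) = σ • ι P))
    (hT : ∃ (L₀ : ℕ) (c γ : ℝ), 0 ≤ γ ∧ ∀ (W : WeierstrassCurve ℚ) [W.IsElliptic] (ℓ : ℕ), ℓ.Prime →
      L₀ < ℓ → c * (max 1 W.stableFaltingsHeight) ^ γ < ℓ → W.HasIrreducibleModPGaloisRep ℓ)
    (hI : ∃ (L₀ : ℕ) (γ c : ℝ), 0 ≤ γ ∧ ∀ (W : WeierstrassCurve ℚ) [W.IsElliptic]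
      (E B : AbelianVariety.{0} ℚ) (e : E.geomPoints ≃+ W.geomPoints),
      (∀ (σ : Field.absoluteGaloisGroup ℚ) (P : E.geomPoints), e (σ • P) = σ • e P) →
      (∀ (C : AbelianVariety.{0} (AlgebraicClosure ℚ))
          (g : B.baseChange (AlgebraicClosure ℚ) ⟶ C),
          Surjective (AbelianVariety.Hom.toSchemeHom g) → C.dim ≠ 0 →
          ∃ f : E.baseChange (AlgebraicClosure ℚ) ⟶ C, f ≠ 0) →
      ∀ ℓ : ℕ, ℓ.Prime → L₀ < ℓ →
      (∃ (α : E ⟶ B) (β : B ⟶ E) (n : ℤ), n ≠ 0 ∧ α ≫ β = n • 𝟙 E) →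
      (∀ (α : E ⟶ B) (β : B ⟶ E) (n : ℤ), α ≫ β = n • 𝟙 E → (ℓ : ℤ) ∣ n) →
        (ℓ : ℝ) ≤ c * ((B.dim : ℝ) * max 1 W.stableFaltingsHeight) ^ γ)
    (hF : ∃ κ C : ℝ, 0 ≤ κ ∧ ∀ (W : WeierstrassCurve ℚ) [W.IsElliptic] (E A : AbelianVariety.{0} ℚ)
      (e : E.geomPoints ≃+ W.geomPoints),
      (∀ (σ : Field.absoluteGaloisGroup ℚ) (P : E.geomPoints), e (σ • P) = σ • e P) →
      (∀ f : E.baseChange (AlgebraicClosure ℚ) ⟶ A.baseChange (AlgebraicClosure ℚ), f = 0) →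
      ∀ ℓ : ℕ, ℓ.Prime → W.HasIrreducibleModPGaloisRep ℓ →
      (∃ ι : W.geomTorsion ℓ →+ A.geomPoints, Function.Injective ι ∧
        ∀ (σ : Field.absoluteGaloisGroup ℚ) (P : W.geomTorsion ℓ), ι (σ • P) = σ • ι P) →
        (ℓ : ℝ) ≤ C * (((A.dim : ℝ) + 1) * max 1 W.stableFaltingsHeight) ^ κ) :
    ∃ κ C : ℝ, 0 ≤ κ ∧ ∀ (W : WeierstrassCurve ℚ) [W.IsElliptic] (E B : AbelianVariety.{0} ℚ)
      (e : E.geomPoints ≃+ W.geomPoints),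
      (∀ (σ : Field.absoluteGaloisGroup ℚ) (P : E.geomPoints), e (σ • P) = σ • e P) →
      ∀ ℓ : ℕ, ℓ.Prime →
        (∃ (α : E ⟶ B) (β : B ⟶ E) (n : ℤ), n ≠ 0 ∧ α ≫ β = n • 𝟙 E) →
        (∀ (α : E ⟶ B) (β : B ⟶ E) (n : ℤ), α ≫ β = n • 𝟙 E → (ℓ : ℤ) ∣ n) →
          (ℓ : ℝ) ≤ C * ((B.dim : ℝ) * max 1 W.stableFaltingsHeight) ^ κ := by
  obtain ⟨L₀, c₀, γ₀, hγ₀, hT⟩ := hT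
  obtain ⟨L₁, γ, c, hγ, hI⟩ := hI
  obtain ⟨κ, C, hκ, hF⟩ := hF
  refine ⟨max 1 (max γ₀ (max γ κ)), ((max L₀ L₁ : ℕ) : ℝ) + max c₀ 0 + max c 0 + max C 0,
    zero_le_one.trans (le_max_left _ _), ?_⟩
  intro W _ E B e he ℓ hℓ hex hall
  set κ' : ℝ := max 1 (max γ₀ (max γ κ)) with hκ'
  set C' : ℝ := ((max L₀ L₁ : ℕ) : ℝ) + max c₀ 0 + max c 0 + max C 0 with hC'
  set X : ℝ := (B.dim : ℝ) * max 1 W.stableFaltingsHeight with hX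
  have hdim : (1 : ℝ) ≤ B.dim := by
    exact_mod_cast Nat.one_le_iff_ne_zero.2
      (EllipticGluingPrimeBound.Negative.dim_ne_zero_of_multiplier e hex)
  have hh : (1 : ℝ) ≤ max 1 W.stableFaltingsHeight := le_max_left _ _
  have hm0 : (0 : ℝ) ≤ max 1 W.stableFaltingsHeight := zero_le_one.trans hh
  have hX1 : 1 ≤ X := by rw [hX]; nlinarith
  have hmX : max 1 W.stableFaltingsHeight ≤ X := by
    rw [hX]
    calc max 1 W.stableFaltingsHeight = 1 * max 1 W.stableFaltingsHeight := (one_mul _).symm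
      _ ≤ (B.dim : ℝ) * max 1 W.stableFaltingsHeight := mul_le_mul_of_nonneg_right hdim hm0
  have hκ'1 : 1 ≤ κ' := le_max_left _ _
  have hκ'0 : 0 ≤ κ' := zero_le_one.trans hκ'1
  have hγ₀κ' : γ₀ ≤ κ' := (le_max_left _ _).trans (le_max_right _ _)
  have hγκ' : γ ≤ κ' := ((le_max_left _ _).trans (le_max_right _ _)).trans (le_max_right _ _)
  have hκκ' : κ ≤ κ' := ((le_max_right _ _).trans (le_max_right _ _)).trans (le_max_right _ _)
  have hXpow1 : 1 ≤ X ^ κ' := Real.one_le_rpow hX1 hκ'0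
  have hXpow0 : 0 ≤ X ^ κ' := zero_le_one.trans hXpow1
  have hM0 : (0 : ℝ) ≤ ((max L₀ L₁ : ℕ) : ℝ) := Nat.cast_nonneg _
  have hc₀0 : (0 : ℝ) ≤ max c₀ 0 := le_max_right _ _
  have hc0 : (0 : ℝ) ≤ max c 0 := le_max_right _ _
  have hC0 : (0 : ℝ) ≤ max C 0 := le_max_right _ _
  have key : ∀ K : ℝ, K ≤ C' → (ℓ : ℝ) ≤ K * X ^ κ' → (ℓ : ℝ) ≤ C' * X ^ κ' :=
    fun K hK h ↦ h.trans (mul_le_mul_of_nonneg_right hK hXpow0)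
  by_cases hsmall : ℓ ≤ max L₀ L₁
  · refine key ((max L₀ L₁ : ℕ) : ℝ) (by rw [hC']; linarith) ?_
    calc (ℓ : ℝ) ≤ ((max L₀ L₁ : ℕ) : ℝ) := by exact_mod_cast hsmall
      _ = ((max L₀ L₁ : ℕ) : ℝ) * 1 := (mul_one _).symm
      _ ≤ ((max L₀ L₁ : ℕ) : ℝ) * X ^ κ' := mul_le_mul_of_nonneg_left hXpow1 hM0
  · push Not at hsmall
    have hL₀ : L₀ < ℓ := lt_of_le_of_lt (le_max_left _ _) hsmall
    have hL₁ : L₁ < ℓ := lt_of_le_of_lt (le_max_right _ _) hsmall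
    by_cases hthr : (ℓ : ℝ) ≤ c₀ * (max 1 W.stableFaltingsHeight) ^ γ₀
    · -- below the (height-dependent) irreducibility threshold: the bound holds trivially
      refine key (max c₀ 0) (by rw [hC']; linarith) ?_
      have hY0 : (0 : ℝ) ≤ (max 1 W.stableFaltingsHeight) ^ γ₀ := Real.rpow_nonneg hm0 γ₀
      calc (ℓ : ℝ) ≤ c₀ * (max 1 W.stableFaltingsHeight) ^ γ₀ := hthr
        _ ≤ max c₀ 0 * (max 1 W.stableFaltingsHeight) ^ γ₀ :=
            mul_le_mul_of_nonneg_right (le_max_left _ _) hY0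
        _ ≤ max c₀ 0 * X ^ γ₀ :=
            mul_le_mul_of_nonneg_left (Real.rpow_le_rpow hm0 hmX hγ₀) hc₀0
        _ ≤ max c₀ 0 * X ^ κ' :=
            mul_le_mul_of_nonneg_left (Real.rpow_le_rpow_of_exponent_le hX1 hγ₀κ') hc₀0
    · push Not at hthr
      have hirr : W.HasIrreducibleModPGaloisRep ℓ := hT W ℓ hℓ hL₀ hthr
      rcases hD W E B e he ℓ hℓ hirr hex hall with
        ⟨B₁, hB₁, hiso, hex₁, hall₁⟩ | ⟨A, hA, hfree, hemb⟩
      · refine key (max c 0) (by rw [hC']; linarith) ?_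
        have hI1 := hI W E B₁ e he hiso ℓ hℓ hL₁ hex₁ hall₁
        have hB₁' : (B₁.dim : ℝ) ≤ B.dim := by exact_mod_cast hB₁
        have hY0 : (0 : ℝ) ≤ (B₁.dim : ℝ) * max 1 W.stableFaltingsHeight :=
          mul_nonneg (Nat.cast_nonneg _) hm0
        have hYX : (B₁.dim : ℝ) * max 1 W.stableFaltingsHeight ≤ X := by
          rw [hX]; exact mul_le_mul_of_nonneg_right hB₁' hm0
        calc (ℓ : ℝ) ≤ c * ((B₁.dim : ℝ) * max 1 W.stableFaltingsHeight) ^ γ := hI1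
          _ ≤ max c 0 * ((B₁.dim : ℝ) * max 1 W.stableFaltingsHeight) ^ γ :=
              mul_le_mul_of_nonneg_right (le_max_left _ _) (Real.rpow_nonneg hY0 γ)
          _ ≤ max c 0 * X ^ γ := mul_le_mul_of_nonneg_left (Real.rpow_le_rpow hY0 hYX hγ) hc0
          _ ≤ max c 0 * X ^ κ' :=
              mul_le_mul_of_nonneg_left (Real.rpow_le_rpow_of_exponent_le hX1 hγκ') hc0
      · refine key (max C 0) (by rw [hC']; linarith) ?_
        have hF1 := hF W E A e he hfree ℓ hℓ hirr hemb
        have hA' : (A.dim : ℝ) + 1 ≤ B.dim := by exact_mod_cast hA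
        have hY0 : (0 : ℝ) ≤ ((A.dim : ℝ) + 1) * max 1 W.stableFaltingsHeight :=
          mul_nonneg (by positivity) hm0
        have hYX : ((A.dim : ℝ) + 1) * max 1 W.stableFaltingsHeight ≤ X := by
          rw [hX]; exact mul_le_mul_of_nonneg_right hA' hm0
        calc (ℓ : ℝ) ≤ C * (((A.dim : ℝ) + 1) * max 1 W.stableFaltingsHeight) ^ κ := hF1
          _ ≤ max C 0 * (((A.dim : ℝ) + 1) * max 1 W.stableFaltingsHeight) ^ κ :=
              mul_le_mul_of_nonneg_right (le_max_left _ _) (Real.rpow_nonneg hY0 κ)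
          _ ≤ max C 0 * X ^ κ := mul_le_mul_of_nonneg_left (Real.rpow_le_rpow hY0 hYX hκ) hC0
          _ ≤ max C 0 * X ^ κ' :=
              mul_le_mul_of_nonneg_left (Real.rpow_le_rpow_of_exponent_le hX1 hκκ') hC0

/-- **Reduction theorem of line Sketch, final (v12) form: `U_simple` + three inputs ⟹ U.** The
Masser–Wüstholz fact, the CM torsion fact, the route item `FaltingsTate` and `U_simple` imply
`EllipticGluingPrimeBound`. Composition of `bound_of_branches₃` with the landed stubs: splitting +
Case-B engine into the dichotomy-given-irreducibility, the irreducibility threshold from the two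
facts, Minkowski + the Masser–Wüstholz leaf + rational-part reduction + big-image core + CM core
(with `FaltingsTate`) into the polynomial isotypic branch, and `U_simple` through
`stub_freeOfSimple` (induction on `dim A` along `stub_quotientByAbelianSubvariety`) into the free
branch. Conditional result (does not close the item). -/
theorem ellipticGluingPrimeBound_of_simple
    (hMW : Literature.NumberTheory.EllipticCurves.masserWustholz_surjective_modEll)
    (hCM : Literature.NumberTheory.EllipticCurves.cmTorsion_cartanImage)
    (hFal : FaltingsTate)
    (hS : ∃ κ C : ℝ, 0 ≤ κ ∧ ∀ (W : WeierstrassCurve ℚ) [W.IsElliptic] (E A : AbelianVariety.{0} ℚ)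
      (e : E.geomPoints ≃+ W.geomPoints),
      (∀ (σ : Field.absoluteGaloisGroup ℚ) (P : E.geomPoints), e (σ • P) = σ • e P) →
      (∀ f : E.baseChange (AlgebraicClosure ℚ) ⟶ A.baseChange (AlgebraicClosure ℚ), f = 0) →
      AbelianVariety.IsSimple A →
      ∀ ℓ : ℕ, ℓ.Prime → W.HasIrreducibleModPGaloisRep ℓ →
      (∃ ι : W.geomTorsion ℓ →+ A.geomPoints, Function.Injective ι ∧
        ∀ (σ : Field.absoluteGaloisGroup ℚ) (P : W.geomTorsion ℓ), ι (σ • P) = σ • ι P) →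
        (ℓ : ℝ) ≤ C * (((A.dim : ℝ) + 1) * max 1 W.stableFaltingsHeight) ^ κ) :
    EllipticGluingPrimeBound :=
  bound_of_branches₃
    (stub_dichotomyOfIrreducible stub_geomIsotypicSplitting
      (fun W _ E B B₁ B₂ e he ℓ hℓ hirr hall i j hi hσ α₀ β₀ m hm hndvd ↦ by
        haveI := hi
        exact stub_caseB e he hℓ hirr hall i j hσ α₀ β₀ m hm hndvd))
    (stub_irreducibleThreshold hMW hCM)
    (stub_isotypicBranchPolyOf
      (fun r ℓ hℓ G hG h ↦ by haveI := hG; exact stub_minkowski r ℓ hℓ G h)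
      (by exact hMW)
      (fun _ _ _ _ e he hiso _ hℓ hirr hsc hex hall ↦
        stub_rationalPartReduction e he hiso hℓ hirr hsc hex hall)
      stub_bigImageTorsionCore
      (stub_CMIsotypicCoreOf (by exact hCM)
        (stub_CMTorsionCoreOf (fun A B ℓ _ ↦ hFal A B ℓ) (by exact hCM))))
    (stub_freeOfSimple hS stub_quotientByAbelianSubvariety)

/-- **U ⟺ U_simple modulo the three inputs.** Given the Masser–Wüstholz fact, the CM torsion fact
and the route item `FaltingsTate`, the crux `EllipticGluingPrimeBound` is EQUIVALENT to the line's
residual `U_simple` (height-free torsion sharing with ℚ-simple geometrically `E`-free partners at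
primes of irreducible `W[ℓ]`): `→` is unconditional
(`simpleFreeTorsionBound_of_ellipticGluingPrimeBound`, the gluing construction), `←` is
`ellipticGluingPrimeBound_of_simple`. -/
theorem ellipticGluingPrimeBound_iff_simple
    (hMW : Literature.NumberTheory.EllipticCurves.masserWustholz_surjective_modEll)
    (hCM : Literature.NumberTheory.EllipticCurves.cmTorsion_cartanImage)
    (hFal : FaltingsTate) :
    EllipticGluingPrimeBound ↔
    ∃ κ C : ℝ, 0 ≤ κ ∧ ∀ (W : WeierstrassCurve ℚ) [W.IsElliptic] (E A : AbelianVariety.{0} ℚ)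
      (e : E.geomPoints ≃+ W.geomPoints),
      (∀ (σ : Field.absoluteGaloisGroup ℚ) (P : E.geomPoints), e (σ • P) = σ • e P) →
      (∀ f : E.baseChange (AlgebraicClosure ℚ) ⟶ A.baseChange (AlgebraicClosure ℚ), f = 0) →
      AbelianVariety.IsSimple A →
      ∀ ℓ : ℕ, ℓ.Prime → W.HasIrreducibleModPGaloisRep ℓ →
      (∃ ι : W.geomTorsion ℓ →+ A.geomPoints, Function.Injective ι ∧
        ∀ (σ : Field.absoluteGaloisGroup ℚ) (P : W.geomTorsion ℓ), ι (σ • P) = σ • ι P) →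
        (ℓ : ℝ) ≤ C * (((A.dim : ℝ) + 1) * max 1 W.stableFaltingsHeight) ^ κ :=
  ⟨simpleFreeTorsionBound_of_ellipticGluingPrimeBound, ellipticGluingPrimeBound_of_simple hMW hCM hFal⟩

end Summit.ABC.ABC.Theorems.IsotypicMinkowski

end
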